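import Literature.Analysis.FluidPDE.BurgersVortexSteady
import HarnessLib

/-!
# The peak swirl speed of the Burgers vortex (Lamb–Oseen–Rott constant)

Analysis/FluidPDE proofs file (all results proved; no definitions, no named facts). Cell
`ns-blowup`, seat `ns-blowup-ecbridge-8` (g3); supports the crux `HeredityFromTwo` of
`Summits/NavierStokesRegularity` (route `PalasekTowerBreakdown`), whose upper half is a sup-norm
ceiling and whose lower half bets on strained-tube (Burgers) compaction — the register reading is
the Summit-side file `Theorems/PalasekTowerBreakdownHeredityFromTwoBurgersNumber.lean`.

The tree's `burgersVortexSwirl γ ν Γ` (file `BurgersVortex.lean`) is the azimuthal velocity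
`v(x) = (Γ/2πr)(1 − e^{−γr²/4ν}) e_θ`, `r² = x₀² + x₁²`, of the Burgers vortex with strain rate `γ`,
viscosity `ν` and total circulation `Γ` — the `t → ∞` limit of the Lamb–Oseen vortex with
`4νt ↦ 4ν/γ` (Saffman 1992, §13.1 (3) and §13.3 (12), (31): "The axisymmetric steady Burgers vortex
is the limit as `t → ∞`"). `BurgersVortexSteady.lean` proves the point-vortex bound
`|v(x)| ≤ |Γ|/(2πr)` (`norm_burgersVortexSwirl_le`), which degenerates on the axis. Here we prove the
UNIFORM bound: writing `t = γr²/4ν` and `δ = (ν/γ)^{1/2}` (`burgersCoreRadius`),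

  `|v(x)|² = (Γ²γ/16π²ν) · tφ(t)²`,  `tφ(t)² = (1 − e^{−t})²/t`    (`norm_sq_burgersVortexSwirl_eq_profile`),

so `|v(x)| = (|Γ|/4πδ) · μ(s)` with `μ(s) = (1 − e^{−s²})/s`, `s = r/2δ`. The printed facts
(Saffman 1992, §13.1 (4), for the Lamb–Oseen profile (3)): the tangential velocity is maximal at
`r₁ = 2.24 √(νt)` where the circulation is `Γ₁ = 0.716 Γ₀`, i.e. `max_s μ(s) = 0.716/1.12 = 0.638`
attained at `s² = 1.256` (the root of `2s² = e^{s²} − 1`); for the Burgers vortex `r₁ = 2.24 δ` and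

  `sup_x |v(x)| = 0.638 · |Γ|/(4πδ) = 0.0508 · |Γ| (γ/ν)^{1/2}`.

We prove, with elementary constants bracketing `0.638`:

* `norm_burgersVortexSwirl_le_peak`: `|v(x)| ≤ |Γ|(γ/ν)^{1/2}/(4√2 π)` for EVERY `x ∈ EuclideanSpace ℝ (Fin 3)` (axis
  included), i.e. the constant `1/√2 = 0.707` in place of `0.638`, from the inequality
  `(1 − e^{−t})² ≤ t/2` (`t ≥ 0`), whose derivative form is `½ − 2e^{−t}(1 − e^{−t}) = ½(2e^{−t} − 1)² ≥ 0`;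
* `norm_burgersVortexSwirl_two_coreRadius`: at `r = 2δ` (`s = 1`, `t = 1`) the speed is EXACTLY
  `(1 − e^{−1}) |Γ|(γ/ν)^{1/2}/(4π)`, and `1 − e^{−1} ≥ 79/125 = 0.632`
  (`exists_norm_burgersVortexSwirl_ge`), within `1 %` of the printed maximum `0.638`;
* the core-radius forms `|v| ≤ |Γ|/(4√2 π δ)`, and the full field: the strain contributes
  `|U_s(x)| ≤ |γ| |x|` (`norm_axisymmetricStrain_le`), so
  `|burgersVortex γ ν Γ x| ≤ |γ||x| + |Γ|(γ/ν)^{1/2}/(4√2 π)` (`norm_burgersVortex_le`);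
* (v2, the velocity GRADIENT) `fderiv_burgersVortexSwirl_apply` (the gradient formula),
  `fderiv_burgersVortexSwirl_axis` / `norm_fderiv_burgersVortexSwirl_axis`: on the axis `Dv = c·J`
  with `‖Dv‖ = |c| = |γΓ|/(8πν)` — the solid-body core rotating at half the axis vorticity
  `γΓ/(4πν)` (Saffman 1992 §13.3 (12); `burgersVorticity_le_axis`); the uniform bound
  `‖Dv(x)‖ ≤ 3|c|` (`norm_fderiv_burgersVortexSwirl_le`; sharp value `|c|`), and for the full field
  `‖D(burgersVortex)(x)‖ ≤ |γ| + 3|c|` (`norm_fderiv_burgersVortex_le`),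
  `‖D(burgersVortex)(axis)‖ ≥ |c|` (`le_norm_fderiv_burgersVortex_axis`).

WHAT THIS IS NOT: not a statement about any Navier–Stokes flow other than the exact steady,
infinite-energy Burgers vortex.

## References

* P. G. Saffman, *Vortex Dynamics*, Cambridge Univ. Press 1992: §13.1 eqs. (3)–(4) (Lamb–Oseen
  vortex, `Γ₁ = 0.716Γ₀`, `r₁ = 2.24√(νt)`), §13.3 eqs. (9), (12), (31) (Burgers vortex as the
  steady limit). [Saffman1992]
* Th. Gallay, C. E. Wayne, arXiv:math/0503353, §1 (1.4)–(1.5) (core radius `δ = (ν/γ)^{1/2}`).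
  [GallayWayne2006]
-/

noncomputable section

open Set Function Filter Topology WithLp MeasureTheory
open scoped InnerProductSpace RealInnerProductSpace

namespace Literature.Analysis.FluidPDE

/-! ### The scalar inequality `(1 − e^{−t})² ≤ t/2` -/

/-- The auxiliary function `F(t) = t/2 − (1 − e^{−t})²` has derivative
`½ − 2e^{−t}(1 − e^{−t})` everywhere. [folklore] -/
private theorem hasDerivAt_half_sub_sq (t : ℝ) :
    HasDerivAt (fun t : ℝ => t / 2 - (1 - Real.exp (-t)) ^ 2)
      (1 / 2 - 2 * (1 - Real.exp (-t)) * Real.exp (-t)) t := by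
  have h1 : HasDerivAt (fun t : ℝ => t / 2) (1 / 2) t := by
    simpa using (hasDerivAt_id t).div_const 2
  have he : HasDerivAt (fun t : ℝ => Real.exp (-t)) (Real.exp (-t) * (-1)) t :=
    (hasDerivAt_neg t).exp
  have h2 : HasDerivAt (fun t : ℝ => 1 - Real.exp (-t)) (-(Real.exp (-t) * (-1))) t :=
    he.const_sub 1
  have h3 : HasDerivAt (fun t : ℝ => (1 - Real.exp (-t)) ^ 2)
      ((2 : ℕ) * (1 - Real.exp (-t)) ^ (2 - 1) * (-(Real.exp (-t) * (-1)))) t := h2.pow 2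
  refine (h1.sub h3).congr_deriv ?_
  push_cast
  ring

/-- `F(t) = t/2 − (1 − e^{−t})²` is monotone on `ℝ`: its derivative is `½(2e^{−t} − 1)² ≥ 0`. [folklore] -/
private theorem monotone_half_sub_sq :
    Monotone (fun t : ℝ => t / 2 - (1 - Real.exp (-t)) ^ 2) := by
  refine monotone_of_deriv_nonneg (fun t => (hasDerivAt_half_sub_sq t).differentiableAt) ?_
  intro t
  rw [(hasDerivAt_half_sub_sq t).deriv]
  nlinarith [sq_nonneg (2 * Real.exp (-t) - 1)]

/-- **`(1 − e^{−t})² ≤ t/2` for `t ≥ 0`** — the elementary inequality behind the uniform peak bound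
(equality of the optimal constant would be `0.638² t`; `1/2` is what monotonicity gives). [folklore] -/
private theorem sq_one_sub_exp_neg_le {t : ℝ} (ht : 0 ≤ t) :
    (1 - Real.exp (-t)) ^ 2 ≤ t / 2 := by
  have h := monotone_half_sub_sq ht
  simp only [neg_zero, Real.exp_zero, sub_self, ne_eq, OfNat.ofNat_ne_zero, not_false_eq_true,
    zero_pow, zero_div] at h
  linarith

/-- `t φ(t)² ≤ 1/2` for `t ≥ 0` (`tφ(t)² = (1 − e^{−t})²/t` off the origin, `= 0` at `t = 0`):
compare the point-vortex form `tφ(t)² ≤ 1/t` (`mul_burgersPhi_sq_le`). [folklore] -/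
private theorem mul_burgersPhi_sq_le_half {t : ℝ} (ht : 0 ≤ t) :
    t * burgersPhi t ^ 2 ≤ 1 / 2 := by
  rcases ht.eq_or_lt with rfl | ht'
  · simp
  · have hm := mul_burgersPhi t
    have hkey : t * (t * burgersPhi t ^ 2) ≤ t * (1 / 2) := by
      have : t * (t * burgersPhi t ^ 2) = (t * burgersPhi t) ^ 2 := by ring
      rw [this, hm]
      linarith [sq_one_sub_exp_neg_le ht'.le]
    exact le_of_mul_le_mul_left hkey ht'

/-! ### The speed profile of the Burgers swirl -/

/-- **The squared swirl speed as a one-variable profile**: for `ν ≠ 0`,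
`|v(x)|² = (Γ²γ/16π²ν) · tφ(t)²` with `t = γ(x₀² + x₁²)/(4ν)` (so `tφ(t)² = (1 − e^{−t})²/t` off the
axis: Saffman 1992, §13.1 (3) with `4νt ↦ 4ν/γ`, §13.3 (12)). Valid on the axis too (`t = 0`).
[cite: Saffman1992, §13.1 eq. (3) and §13.3 eq. (12)] -/
theorem norm_sq_burgersVortexSwirl_eq_profile {ν : ℝ} (hν : ν ≠ 0) (γ Γ : ℝ) (x : EuclideanSpace ℝ (Fin 3)) :
    ‖burgersVortexSwirl γ ν Γ x‖ ^ 2 =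
      Γ ^ 2 * γ / (16 * Real.pi ^ 2 * ν) *
        (γ * (x 0 ^ 2 + x 1 ^ 2) / (4 * ν) * burgersPhi (γ * (x 0 ^ 2 + x 1 ^ 2) / (4 * ν)) ^ 2) := by
  rw [norm_sq_burgersVortexSwirl]
  field_simp
  ring

/-- **Uniform peak bound for the Burgers swirl (Rott's constant relaxed to `1/√2`).** For
`γ, ν > 0` and every `x ∈ EuclideanSpace ℝ (Fin 3)` (the axis included),

  `|v(x)| ≤ |Γ| (γ/ν)^{1/2} / (4√2 π) = 0.0563 · |Γ|(γ/ν)^{1/2}`.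

Printed: the maximum of the Lamb–Oseen/Burgers tangential velocity is `Γ₁/(2πr₁)` with
`Γ₁ = 0.716 Γ`, `r₁ = 2.24 (ν/γ)^{1/2}`, i.e. `0.0508 · |Γ|(γ/ν)^{1/2}` (Saffman 1992, §13.1 (4) with
§13.3 (31)); we prove the bound with the elementary constant `1/√2 = 0.707 ≥ 0.716/1.12 = 0.638`.
[cite: Saffman1992, §13.1 eq. (4) and §13.3 eq. (31)] -/
theorem norm_burgersVortexSwirl_le_peak {γ ν : ℝ} (hγ : 0 < γ) (hν : 0 < ν) (Γ : ℝ) (x : EuclideanSpace ℝ (Fin 3)) :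
    ‖burgersVortexSwirl γ ν Γ x‖ ≤ |Γ| * Real.sqrt (γ / ν) / (4 * Real.sqrt 2 * Real.pi) := by
  have hpi := Real.pi_pos
  have h2 : (0 : ℝ) < Real.sqrt 2 := Real.sqrt_pos.2 (by norm_num)
  have hR : 0 ≤ |Γ| * Real.sqrt (γ / ν) / (4 * Real.sqrt 2 * Real.pi) := by positivity
  rw [← sq_le_sq₀ (norm_nonneg _) hR, norm_sq_burgersVortexSwirl_eq_profile hν.ne' γ Γ x]
  have ht : 0 ≤ γ * (x 0 ^ 2 + x 1 ^ 2) / (4 * ν) := by positivity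
  have hφ := mul_burgersPhi_sq_le_half ht
  have hsq : (|Γ| * Real.sqrt (γ / ν) / (4 * Real.sqrt 2 * Real.pi)) ^ 2 =
      Γ ^ 2 * γ / (16 * Real.pi ^ 2 * ν) * (1 / 2) := by
    rw [div_pow, mul_pow, mul_pow, mul_pow, sq_abs, Real.sq_sqrt (div_pos hγ hν).le,
      Real.sq_sqrt (by norm_num : (0 : ℝ) ≤ 2)]
    field_simp
    ring
  rw [hsq]
  have hc : 0 ≤ Γ ^ 2 * γ / (16 * Real.pi ^ 2 * ν) := by positivity
  exact mul_le_mul_of_nonneg_left hφ hc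

/-- `(γ/ν)^{1/2} = 1/δ` with `δ = burgersCoreRadius γ ν = (ν/γ)^{1/2}`, for `γ, ν > 0`. [cite: GallayWayne2006, §1 (1.4)] -/
theorem sqrt_div_eq_inv_burgersCoreRadius (γ ν : ℝ) :
    Real.sqrt (γ / ν) = (burgersCoreRadius γ ν)⁻¹ := by
  rw [burgersCoreRadius, ← Real.sqrt_inv, inv_div]

/-- **Peak bound in core-radius form**: `|v(x)| ≤ |Γ|/(4√2 π δ)`, `δ = (ν/γ)^{1/2}` (printed maximum
`0.638 |Γ|/(4πδ)` at `r = 2.24 δ`, Saffman 1992 §13.1 (4)). [cite: Saffman1992, §13.1 eq. (4) and §13.3 eq. (31)] -/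
theorem norm_burgersVortexSwirl_le_peak_coreRadius {γ ν : ℝ} (hγ : 0 < γ) (hν : 0 < ν) (Γ : ℝ)
    (x : EuclideanSpace ℝ (Fin 3)) :
    ‖burgersVortexSwirl γ ν Γ x‖ ≤ |Γ| / (4 * Real.sqrt 2 * Real.pi * burgersCoreRadius γ ν) := by
  have h := norm_burgersVortexSwirl_le_peak hγ hν Γ x
  rw [sqrt_div_eq_inv_burgersCoreRadius γ ν] at h
  have hδ : 0 < burgersCoreRadius γ ν := Real.sqrt_pos.2 (div_pos hν hγ)
  calc ‖burgersVortexSwirl γ ν Γ x‖ ≤ |Γ| * (burgersCoreRadius γ ν)⁻¹ / (4 * Real.sqrt 2 * Real.pi) := h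
    _ = |Γ| / (4 * Real.sqrt 2 * Real.pi * burgersCoreRadius γ ν) := by
      field_simp

/-! ### The speed at twice the core radius: a matching floor -/

/-- **The swirl speed at `r = 2δ` is exactly `(1 − e^{−1}) |Γ|(γ/ν)^{1/2}/(4π)`** (`s = 1`,
`t = γr²/4ν = 1` in the profile; Saffman 1992 §13.1 (3): `v = (Γ/2πr)(1 − e^{−r²/4νt})`).
[cite: Saffman1992, §13.1 eq. (3) and §13.3 eq. (12)] -/
theorem norm_burgersVortexSwirl_two_coreRadius {γ ν : ℝ} (hγ : 0 < γ) (hν : 0 < ν) (Γ : ℝ) :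
    ∃ x : EuclideanSpace ℝ (Fin 3), x 0 ^ 2 + x 1 ^ 2 = 4 * ν / γ ∧
      ‖burgersVortexSwirl γ ν Γ x‖ = (1 - Real.exp (-1)) * (|Γ| * Real.sqrt (γ / ν) / (4 * Real.pi)) := by
  -- the point `(2δ, 0, 0)`, `δ = (ν/γ)^{1/2}`
  have hsq : (toLp 2 ![2 * Real.sqrt (ν / γ), 0, 0] : EuclideanSpace ℝ (Fin 3)) 0 ^ 2 +
      (toLp 2 ![2 * Real.sqrt (ν / γ), 0, 0] : EuclideanSpace ℝ (Fin 3)) 1 ^ 2 = 4 * ν / γ := by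
    simp only [Matrix.cons_val_zero, Matrix.cons_val_one]
    rw [mul_pow, Real.sq_sqrt (div_pos hν hγ).le]
    ring
  refine ⟨toLp 2 ![2 * Real.sqrt (ν / γ), 0, 0], hsq, ?_⟩
  have hpi := Real.pi_pos
  have he : 0 ≤ 1 - Real.exp (-1 : ℝ) := by
    rw [sub_nonneg, Real.exp_le_one_iff]; norm_num
  have hR : 0 ≤ (1 - Real.exp (-1)) * (|Γ| * Real.sqrt (γ / ν) / (4 * Real.pi)) := by positivity
  rw [← sq_eq_sq₀ (norm_nonneg _) hR, norm_sq_burgersVortexSwirl_eq_profile hν.ne', hsq]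
  have ht : γ * (4 * ν / γ) / (4 * ν) = 1 := by field_simp
  rw [ht, one_mul]
  have hφ : burgersPhi 1 = 1 - Real.exp (-1) := by
    have := mul_burgersPhi 1; rwa [one_mul] at this
  rw [hφ, mul_pow, div_pow, mul_pow, mul_pow, sq_abs, Real.sq_sqrt (div_pos hγ hν).le]
  field_simp
  ring

/-- `1 − e^{−1} ≥ 79/125 = 0.632` (from `e > 2.7182818283`). [folklore] -/
private theorem one_sub_exp_neg_one_ge : (79 : ℝ) / 125 ≤ 1 - Real.exp (-1) := by
  have he := Real.exp_one_gt_d9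
  have hpos := Real.exp_pos (1 : ℝ)
  rw [Real.exp_neg]
  have : (Real.exp 1)⁻¹ ≤ 46 / 125 := by
    rw [inv_le_comm₀ hpos (by norm_num)]
    linarith
  linarith

/-- **A matching floor for the peak**: some point carries swirl speed at least
`0.632 · |Γ|(γ/ν)^{1/2}/(4π)`, within `1 %` of the printed maximum `0.638 · |Γ|(γ/ν)^{1/2}/(4π)`
(Saffman 1992, §13.1 (4): `Γ₁/r₁ = 0.716/2.24` in units of `Γ/(ν t)^{1/2}`, here `(νt)^{1/2} ↦ δ`).
Together with `norm_burgersVortexSwirl_le_peak`: `0.632 K ≤ sup_x |v(x)| ≤ 0.708 K`,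
`K = |Γ|(γ/ν)^{1/2}/(4π)`. [cite: Saffman1992, §13.1 eq. (4) and §13.3 eq. (31)] -/
theorem exists_norm_burgersVortexSwirl_ge {γ ν : ℝ} (hγ : 0 < γ) (hν : 0 < ν) (Γ : ℝ) :
    ∃ x : EuclideanSpace ℝ (Fin 3), (79 / 125) * (|Γ| * Real.sqrt (γ / ν) / (4 * Real.pi)) ≤ ‖burgersVortexSwirl γ ν Γ x‖ := by
  obtain ⟨x, -, hx⟩ := norm_burgersVortexSwirl_two_coreRadius hγ hν Γ
  refine ⟨x, ?_⟩
  rw [hx]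
  have hK : 0 ≤ |Γ| * Real.sqrt (γ / ν) / (4 * Real.pi) := by
    have := Real.pi_pos; positivity
  exact mul_le_mul_of_nonneg_right one_sub_exp_neg_one_ge hK

/-- **The peak bracket**, packaged: for `γ, ν > 0` the swirl speed of the Burgers vortex is bounded
by `K/√2` everywhere and reaches `(79/125) K` somewhere, `K = |Γ|(γ/ν)^{1/2}/(4π)` (printed sharp
value `0.638 K`, Saffman 1992 §13.1 (4)). [cite: Saffman1992, §13.1 eq. (4) and §13.3 eq. (31)] -/
theorem burgersVortexSwirl_peak_bracket {γ ν : ℝ} (hγ : 0 < γ) (hν : 0 < ν) (Γ : ℝ) :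
    (∀ x : EuclideanSpace ℝ (Fin 3), ‖burgersVortexSwirl γ ν Γ x‖ ≤ (Real.sqrt 2)⁻¹ * (|Γ| * Real.sqrt (γ / ν) / (4 * Real.pi))) ∧
      ∃ x : EuclideanSpace ℝ (Fin 3), (79 / 125) * (|Γ| * Real.sqrt (γ / ν) / (4 * Real.pi)) ≤ ‖burgersVortexSwirl γ ν Γ x‖ := by
  refine ⟨fun x => ?_, exists_norm_burgersVortexSwirl_ge hγ hν Γ⟩
  have h := norm_burgersVortexSwirl_le_peak hγ hν Γ x
  have h2 : (0 : ℝ) < Real.sqrt 2 := Real.sqrt_pos.2 (by norm_num)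
  have hpi := Real.pi_pos
  calc ‖burgersVortexSwirl γ ν Γ x‖ ≤ |Γ| * Real.sqrt (γ / ν) / (4 * Real.sqrt 2 * Real.pi) := h
    _ = (Real.sqrt 2)⁻¹ * (|Γ| * Real.sqrt (γ / ν) / (4 * Real.pi)) := by
      field_simp

/-! ### The full field: strain plus swirl -/

/-- The axisymmetric strain grows linearly: `|U_s(x)| ≤ |γ| |x|`
(`|U_s(x)|² = γ²(x₀²/4 + x₁²/4 + x₂²) ≤ γ²|x|²`; Saffman 1992 §13.3 (9): `U = −½γx`, `V = −½γy`,
`W = γz`). [cite: Saffman1992, §13.3 eq. (9)] -/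
theorem norm_axisymmetricStrain_le (γ : ℝ) (x : EuclideanSpace ℝ (Fin 3)) : ‖axisymmetricStrain γ x‖ ≤ |γ| * ‖x‖ := by
  have hR : 0 ≤ |γ| * ‖x‖ := by positivity
  rw [← sq_le_sq₀ (norm_nonneg _) hR, mul_pow, sq_abs, EuclideanSpace.norm_sq_eq,
    EuclideanSpace.norm_sq_eq, Fin.sum_univ_three, Fin.sum_univ_three]
  simp only [Real.norm_eq_abs, sq_abs, axisymmetricStrain, linearStrain_apply_zero,
    linearStrain_apply_one, linearStrain_apply_two]
  nlinarith [sq_nonneg (γ * x 0), sq_nonneg (γ * x 1), sq_nonneg γ, sq_nonneg (x 2)]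

/-- **Pointwise bound for the full Burgers vortex**: `|u(x)| ≤ |γ||x| + |Γ|(γ/ν)^{1/2}/(4√2 π)` —
inside the ball of radius `ρ` about the origin the strain contributes at most `|γ|ρ` and the swirl
at most its uniform peak. [cite: Saffman1992, §13.3 eqs. (9), (12)] -/
theorem norm_burgersVortex_le {γ ν : ℝ} (hγ : 0 < γ) (hν : 0 < ν) (Γ : ℝ) (x : EuclideanSpace ℝ (Fin 3)) :
    ‖burgersVortex γ ν Γ x‖ ≤ |γ| * ‖x‖ + |Γ| * Real.sqrt (γ / ν) / (4 * Real.sqrt 2 * Real.pi) := by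
  rw [burgersVortex, Pi.add_apply]
  exact (norm_add_le _ _).trans
    (add_le_add (norm_axisymmetricStrain_le γ x) (norm_burgersVortexSwirl_le_peak hγ hν Γ x))


/-! ### The velocity gradient: the solid-body core on the axis and a uniform bound

On the axis the Burgers swirl is locally a solid-body rotation with angular velocity
`c = γΓ/(8πν) = ω(axis)/2` (half the axis vorticity `ω_m = γΓ/(4πν)`, Saffman 1992 §13.3 (12);
`burgersVorticity_le_axis`): `Dv(axis) = c·J`, of operator norm `|c|`. Off the axis
`Dv(x)h = 2caφ'(aρ)⟪x_h, h⟫ Jx + cφ(aρ) Jh` (`a = γ/4ν`, `ρ = x₀² + x₁²`), whence the elementary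
uniform bound `‖Dv(x)‖ ≤ 3|c|` (the sharp value is `|c|`, attained on the axis; `|tφ'| = |e^{−t} − φ| ≤ 1`,
`φ ≤ 1`). With the strain, `‖D(burgersVortex)(axis)‖ ≥ |c|` and `‖D(burgersVortex)(x)‖ ≤ |γ| + 3|c|`. -/

/-- `‖J h‖ ≤ ‖h‖` (private copy; `J h = (−h₁, h₀, 0)`). [folklore] -/
private theorem norm_rotGen_le_norm' (h : EuclideanSpace ℝ (Fin 3)) : ‖rotGen h‖ ≤ ‖h‖ := by
  rw [← sq_le_sq₀ (norm_nonneg _) (norm_nonneg _), EuclideanSpace.norm_sq_eq,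
    EuclideanSpace.norm_sq_eq, Fin.sum_univ_three, Fin.sum_univ_three]
  simp only [Real.norm_eq_abs, sq_abs, rotGen_apply_zero, rotGen_apply_one, rotGen_apply_two]
  nlinarith [sq_nonneg (h 2)]

/-- `‖J x‖² = x₀² + x₁²` (private copy). [folklore] -/
private theorem norm_rotGen_sq' (x : EuclideanSpace ℝ (Fin 3)) : ‖rotGen x‖ ^ 2 = x 0 ^ 2 + x 1 ^ 2 := by
  rw [EuclideanSpace.norm_sq_eq, Fin.sum_univ_three]
  simp only [Real.norm_eq_abs, sq_abs, rotGen_apply_zero, rotGen_apply_one, rotGen_apply_two]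
  ring

/-- `|v₁| ≤ ‖v‖` on `ℝ³`. [folklore] -/
private theorem abs_apply_one_le_norm' (v : EuclideanSpace ℝ (Fin 3)) : |v 1| ≤ ‖v‖ := by
  rw [← sq_le_sq₀ (abs_nonneg _) (norm_nonneg _), sq_abs, EuclideanSpace.norm_sq_eq, Fin.sum_univ_three]
  simp only [Real.norm_eq_abs, sq_abs]
  nlinarith [sq_nonneg (v 0), sq_nonneg (v 2)]

/-- **The velocity gradient of the Burgers swirl** (all `x`, `h`):
`Dv(x) h = (c · aφ'(aρ) · 2(x₀h₀ + x₁h₁)) Jx + (c φ(aρ)) Jh`, `c = γΓ/(8πν)`, `a = γ/(4ν)`,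
`ρ = x₀² + x₁²` (the tree's azimuthal calculus `fderiv_azimuthal_apply` on the Burgers profile).
[cite: Saffman1992, §13.3 eq. (12)] -/
theorem fderiv_burgersVortexSwirl_apply (γ ν Γ : ℝ) (x h : EuclideanSpace ℝ (Fin 3)) :
    fderiv ℝ (burgersVortexSwirl γ ν Γ) x h =
      (γ * Γ / (8 * Real.pi * ν) * (deriv burgersPhi (γ / (4 * ν) * (x 0 ^ 2 + x 1 ^ 2)) * (γ / (4 * ν))) *
          (2 * (x 0 * h 0 + x 1 * h 1))) • rotGen x +
        (γ * Γ / (8 * Real.pi * ν) * burgersPhi (γ / (4 * ν) * (x 0 ^ 2 + x 1 ^ 2))) • rotGen h := by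
  rw [StrainedAzimuthal.burgersVortexSwirl_eq_azimuthal,
    StrainedAzimuthal.fderiv_azimuthal_apply (StrainedAzimuthal.hasDerivAt_burgersProfile _ _) x h]
  simp only [StrainedAzimuthal.burgersProfile, StrainedAzimuthal.burgersProfileD,
    StrainedAzimuthal.rho_apply]

/-- **On the axis the Burgers swirl is a solid-body rotation**: for `x₀ = x₁ = 0`,
`Dv(x) = c · J` with `c = γΓ/(8πν) = ω(axis)/2` (half the axis vorticity `γΓ/(4πν)` of Saffman 1992
§13.3 (12) / Frisch (8.140)). [cite: Saffman1992, §13.3 eq. (12)] -/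
theorem fderiv_burgersVortexSwirl_axis (γ ν Γ : ℝ) {x : EuclideanSpace ℝ (Fin 3)} (hx0 : x 0 = 0)
    (hx1 : x 1 = 0) :
    fderiv ℝ (burgersVortexSwirl γ ν Γ) x = (γ * Γ / (8 * Real.pi * ν)) • rotGenL := by
  ext h i
  have hJx : rotGen x = 0 := by
    ext j; fin_cases j <;> simp [rotGen, hx0, hx1]
  rw [fderiv_burgersVortexSwirl_apply, hJx, smul_zero, zero_add, hx0, hx1]
  simp

/-- **The operator norm of the swirl gradient on the axis is exactly `|γΓ|/(8π|ν|) = |c|`** (solid-body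
core: `‖cJ‖ = |c|`, `‖J‖ = 1`). [cite: Saffman1992, §13.3 eq. (12)] -/
theorem norm_fderiv_burgersVortexSwirl_axis (γ ν Γ : ℝ) {x : EuclideanSpace ℝ (Fin 3)} (hx0 : x 0 = 0)
    (hx1 : x 1 = 0) :
    ‖fderiv ℝ (burgersVortexSwirl γ ν Γ) x‖ = |γ * Γ / (8 * Real.pi * ν)| := by
  rw [fderiv_burgersVortexSwirl_axis γ ν Γ hx0 hx1]
  have happ : ∀ h : EuclideanSpace ℝ (Fin 3),
      ((γ * Γ / (8 * Real.pi * ν)) • rotGenL) h = (γ * Γ / (8 * Real.pi * ν)) • rotGen h :=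
    fun h => rfl
  apply le_antisymm
  · refine ContinuousLinearMap.opNorm_le_bound _ (abs_nonneg _) fun h => ?_
    rw [happ, norm_smul, Real.norm_eq_abs]
    exact mul_le_mul_of_nonneg_left (norm_rotGen_le_norm' h) (abs_nonneg _)
  · have h1 := ContinuousLinearMap.le_opNorm ((γ * Γ / (8 * Real.pi * ν)) • rotGenL)
      (EuclideanSpace.single 0 (1 : ℝ))
    have hn0 : ‖(EuclideanSpace.single 0 (1 : ℝ) : EuclideanSpace ℝ (Fin 3))‖ = 1 := by simp
    have hn1 : ‖(EuclideanSpace.single 1 (1 : ℝ) : EuclideanSpace ℝ (Fin 3))‖ = 1 := by simp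
    rw [happ, rotGen_single_zero, norm_smul, hn0, hn1, Real.norm_eq_abs, mul_one, mul_one] at h1
    exact h1

/-- **A uniform bound on the swirl gradient**: `‖Dv(x)‖ ≤ 3|c|`, `c = γΓ/(8πν)`, for `γ, ν > 0` and
every `x` (from the gradient formula with `|tφ'(t)| = |e^{−t} − φ(t)| ≤ 1`, `0 < φ ≤ 1`,
`|2(x₀h₀ + x₁h₁)| |Jx| ≤ 2ρ‖h‖`; the sharp value is `|c|`, attained on the axis). [cite: Saffman1992, §13.3 eq. (12)] -/
theorem norm_fderiv_burgersVortexSwirl_le {γ ν : ℝ} (hγ : 0 < γ) (hν : 0 < ν) (Γ : ℝ)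
    (x : EuclideanSpace ℝ (Fin 3)) :
    ‖fderiv ℝ (burgersVortexSwirl γ ν Γ) x‖ ≤ 3 * |γ * Γ / (8 * Real.pi * ν)| := by
  set c := γ * Γ / (8 * Real.pi * ν) with hc
  set a := γ / (4 * ν) with ha
  set ρ := x 0 ^ 2 + x 1 ^ 2 with hρ
  have ha0 : 0 < a := by rw [ha]; positivity
  have hρ0 : 0 ≤ ρ := by rw [hρ]; positivity
  have ht0 : 0 ≤ a * ρ := mul_nonneg ha0.le hρ0
  -- the two scalar profile bounds
  have hφ1 : |burgersPhi (a * ρ)| ≤ 1 := by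
    rw [abs_of_pos (burgersPhi_pos _)]; exact burgersPhi_le_one ht0
  have htφ : |a * ρ * deriv burgersPhi (a * ρ)| ≤ 1 := by
    rw [StrainedAzimuthal.mul_deriv_burgersPhi]
    have h1 : 0 < Real.exp (-(a * ρ)) := Real.exp_pos _
    have h2 : Real.exp (-(a * ρ)) ≤ 1 := Real.exp_le_one_iff.2 (by linarith)
    have h3 := burgersPhi_pos (a * ρ)
    have h4 := burgersPhi_le_one ht0
    rw [abs_le]; constructor <;> linarith
  refine ContinuousLinearMap.opNorm_le_bound _ (by positivity) fun h => ?_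
  rw [fderiv_burgersVortexSwirl_apply]
  have hJx : ‖rotGen x‖ ^ 2 = ρ := by rw [norm_rotGen_sq', hρ]
  have hJh : ‖rotGen h‖ ≤ ‖h‖ := norm_rotGen_le_norm' h
  -- Cauchy–Schwarz in the plane: |x₀h₀ + x₁h₁| ≤ |Jx| ‖h‖
  have hcs : |x 0 * h 0 + x 1 * h 1| ≤ ‖rotGen x‖ * ‖h‖ := by
    rw [← sq_le_sq₀ (abs_nonneg _) (by positivity), sq_abs, mul_pow, hJx, hρ,
      EuclideanSpace.norm_sq_eq, Fin.sum_univ_three]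
    simp only [Real.norm_eq_abs, sq_abs]
    nlinarith [sq_nonneg (x 0 * h 1 - x 1 * h 0), sq_nonneg (h 2), sq_nonneg (x 0), sq_nonneg (x 1)]
  -- first term: `|c|·|aφ'|·2|⟪x_h,h⟫|·|Jx| ≤ 2|c|·|aρφ'(aρ)|·‖h‖ ≤ 2|c|‖h‖`
  have hT1 : ‖(c * (deriv burgersPhi (a * ρ) * a) * (2 * (x 0 * h 0 + x 1 * h 1))) • rotGen x‖ ≤
      2 * |c| * ‖h‖ := by
    rw [norm_smul, Real.norm_eq_abs]
    have e1 : |c * (deriv burgersPhi (a * ρ) * a) * (2 * (x 0 * h 0 + x 1 * h 1))| =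
        2 * |c| * |a * deriv burgersPhi (a * ρ)| * |x 0 * h 0 + x 1 * h 1| := by
      simp only [abs_mul, abs_two]
      ring
    have e2 : |a * ρ * deriv burgersPhi (a * ρ)| = |a * deriv burgersPhi (a * ρ)| * ρ := by
      simp only [abs_mul, abs_of_nonneg hρ0]
      ring
    have hx : ‖rotGen x‖ * ‖h‖ * ‖rotGen x‖ = ρ * ‖h‖ := by
      rw [mul_comm (‖rotGen x‖ * ‖h‖), ← mul_assoc, ← sq, hJx]
    have hnn : 0 ≤ 2 * |c| * |a * deriv burgersPhi (a * ρ)| := by positivity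
    calc |c * (deriv burgersPhi (a * ρ) * a) * (2 * (x 0 * h 0 + x 1 * h 1))| * ‖rotGen x‖
        = 2 * |c| * |a * deriv burgersPhi (a * ρ)| * (|x 0 * h 0 + x 1 * h 1| * ‖rotGen x‖) := by
          rw [e1]; ring
      _ ≤ 2 * |c| * |a * deriv burgersPhi (a * ρ)| * (‖rotGen x‖ * ‖h‖ * ‖rotGen x‖) :=
          mul_le_mul_of_nonneg_left (mul_le_mul_of_nonneg_right hcs (norm_nonneg _)) hnn
      _ = 2 * |c| * |a * ρ * deriv burgersPhi (a * ρ)| * ‖h‖ := by rw [hx, e2]; ring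
      _ ≤ 2 * |c| * 1 * ‖h‖ := by
          have h2c : 0 ≤ 2 * |c| := by positivity
          exact mul_le_mul_of_nonneg_right (mul_le_mul_of_nonneg_left htφ h2c) (norm_nonneg _)
      _ = 2 * |c| * ‖h‖ := by ring
  have hT2 : ‖(c * burgersPhi (a * ρ)) • rotGen h‖ ≤ |c| * ‖h‖ := by
    rw [norm_smul, Real.norm_eq_abs, abs_mul]
    calc |c| * |burgersPhi (a * ρ)| * ‖rotGen h‖ ≤ |c| * 1 * ‖h‖ :=
          mul_le_mul (mul_le_mul_of_nonneg_left hφ1 (abs_nonneg _)) hJh (norm_nonneg _)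
            (by positivity)
      _ = |c| * ‖h‖ := by ring
  have hsplit : γ / (4 * ν) * (x 0 ^ 2 + x 1 ^ 2) = a * ρ := by rw [ha, hρ]
  rw [hsplit]
  calc ‖(c * (deriv burgersPhi (a * ρ) * a) * (2 * (x 0 * h 0 + x 1 * h 1))) • rotGen x +
        (c * burgersPhi (a * ρ)) • rotGen h‖
      ≤ ‖(c * (deriv burgersPhi (a * ρ) * a) * (2 * (x 0 * h 0 + x 1 * h 1))) • rotGen x‖ +
          ‖(c * burgersPhi (a * ρ)) • rotGen h‖ := norm_add_le _ _
    _ ≤ 2 * |c| * ‖h‖ + |c| * ‖h‖ := add_le_add hT1 hT2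
    _ = 3 * |c| * ‖h‖ := by ring

/-- The operator norm of the axisymmetric strain rate: `‖D U_s‖ ≤ |γ|` (`D U_s = diag(−γ/2, −γ/2, γ)`).
[cite: Saffman1992, §13.3 eq. (9)] -/
theorem norm_linearStrainL_axisymmetric_le (γ : ℝ) :
    ‖linearStrainL (-γ / 2) (-γ / 2) γ‖ ≤ |γ| := by
  refine ContinuousLinearMap.opNorm_le_bound _ (abs_nonneg _) fun h => ?_
  rw [linearStrainL_apply]
  exact norm_axisymmetricStrain_le γ h

/-- **The gradient of the full Burgers vortex**: `D u(x) = D U_s + D v(x)`, so for `γ, ν > 0` and every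
`x`, `‖Du(x)‖ ≤ |γ| + 3|γΓ/(8πν)|`. [cite: Saffman1992, §13.3 eqs. (9), (12)] -/
theorem norm_fderiv_burgersVortex_le {γ ν : ℝ} (hγ : 0 < γ) (hν : 0 < ν) (Γ : ℝ)
    (x : EuclideanSpace ℝ (Fin 3)) :
    ‖fderiv ℝ (burgersVortex γ ν Γ) x‖ ≤ |γ| + 3 * |γ * Γ / (8 * Real.pi * ν)| := by
  have hv : DifferentiableAt ℝ (burgersVortexSwirl γ ν Γ) x :=
    ((contDiff_burgersVortexSwirl γ ν Γ (n := 1)).differentiable one_ne_zero) x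
  have hU : HasFDerivAt (axisymmetricStrain γ) (linearStrainL (-γ / 2) (-γ / 2) γ) x :=
    hasFDerivAt_linearStrain _ _ _ x
  rw [burgersVortex, fderiv_add hU.differentiableAt hv, hU.fderiv]
  exact (norm_add_le _ _).trans
    (add_le_add (norm_linearStrainL_axisymmetric_le γ) (norm_fderiv_burgersVortexSwirl_le hγ hν Γ x))

/-- **The gradient of the full Burgers vortex on the axis is at least the core rotation rate**:
`‖Du(axis)‖ ≥ |γΓ|/(8πν)` (test vector `e₀`: `Du e₀ = −(γ/2)e₀ + c e₁`). [cite: Saffman1992, §13.3 eqs. (9), (12)] -/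
theorem le_norm_fderiv_burgersVortex_axis (γ ν Γ : ℝ) {x : EuclideanSpace ℝ (Fin 3)} (hx0 : x 0 = 0)
    (hx1 : x 1 = 0) :
    |γ * Γ / (8 * Real.pi * ν)| ≤ ‖fderiv ℝ (burgersVortex γ ν Γ) x‖ := by
  have hv : DifferentiableAt ℝ (burgersVortexSwirl γ ν Γ) x :=
    ((contDiff_burgersVortexSwirl γ ν Γ (n := 1)).differentiable one_ne_zero) x
  have hU : HasFDerivAt (axisymmetricStrain γ) (linearStrainL (-γ / 2) (-γ / 2) γ) x :=
    hasFDerivAt_linearStrain _ _ _ x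
  rw [burgersVortex, fderiv_add hU.differentiableAt hv, hU.fderiv,
    fderiv_burgersVortexSwirl_axis γ ν Γ hx0 hx1]
  set c := γ * Γ / (8 * Real.pi * ν)
  set L := linearStrainL (-γ / 2) (-γ / 2) γ + c • rotGenL
  have h1 := ContinuousLinearMap.le_opNorm L (EuclideanSpace.single 0 (1 : ℝ))
  have hn0 : ‖(EuclideanSpace.single 0 (1 : ℝ) : EuclideanSpace ℝ (Fin 3))‖ = 1 := by simp
  rw [hn0, mul_one] at h1
  refine le_trans ?_ h1
  -- `L e₀ = (−γ/2, c, 0)` has norm ≥ |c|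
  have hL : L (EuclideanSpace.single 0 (1 : ℝ)) 1 = c := by
    simp [L, linearStrain, rotGen]
  calc |c| = |L (EuclideanSpace.single 0 (1 : ℝ)) 1| := by rw [hL]
    _ ≤ ‖L (EuclideanSpace.single 0 (1 : ℝ))‖ := abs_apply_one_le_norm' _

/-! ### The sharp gradient bound: the swirl gradient is the local angular velocity (v3)

The exact size of the gradient of the Burgers swirl `v = cφ(aρ)Jx` (`c = γΓ/(8πν)`, `a = γ/4ν`):
`‖Dv(x)h‖² = (cφ)²|h_h|² + 4c²a φ'(aρ) e^{−aρ}⟪x_h, h⟫²` with `φ' ≤ 0`, whence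
**`‖Dv(x)‖ ≤ |c|·φ(aρ(x))`** — the local ANGULAR VELOCITY `|v(x)|/r` of the swirl (test vector
`e_θ`), at most the core rotation rate `|c|` (the axis value, `norm_fderiv_burgersVortexSwirl_axis`)
and at most the potential-vortex rate `|Γ|/(2πr²)` far out; hence
`‖D(U_s + v)(x)‖ ≤ |γ| + |c|φ(aρ) ≤ |γ| + |c|` (v2 had the elementary `|γ| + 3|c|`). -/

/-- `e^{−s} ≤ φ(s)` for `s ≥ 0` (`(1 + s)e^{−s} ≤ 1`; a private copy of
`BurgersPhiTemperate.exp_neg_le_burgersPhi`, kept local so as not to import that module). [folklore] -/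
private theorem exp_neg_le_burgersPhi_aux {s : ℝ} (hs : 0 ≤ s) : Real.exp (-s) ≤ burgersPhi s := by
  rcases hs.eq_or_lt with h | h
  · rw [← h]; simp
  · rw [burgersPhi_of_ne_zero h.ne', le_div_iff₀ h]
    have h1 := Real.add_one_le_exp s
    have h2 : Real.exp (-s) * Real.exp s = 1 := by rw [← Real.exp_add]; simp
    nlinarith [Real.exp_pos (-s)]

/-- `φ' ≤ 0` on `(0, ∞)` (`sφ'(s) = e^{−s} − φ(s) ≤ 0`). [folklore] -/
private theorem deriv_burgersPhi_nonpos {s : ℝ} (hs : 0 < s) : deriv burgersPhi s ≤ 0 := by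
  have h := StrainedAzimuthal.mul_deriv_burgersPhi s
  have h2 := exp_neg_le_burgersPhi_aux hs.le
  nlinarith

/-- `‖αJx + βJh‖² = α²ρ + 2αβ(x₀h₀ + x₁h₁) + β²(h₀² + h₁²)`. [folklore] -/
private theorem norm_sq_rotGen_comb (α β : ℝ) (x h : EuclideanSpace ℝ (Fin 3)) :
    ‖α • rotGen x + β • rotGen h‖ ^ 2 =
      α ^ 2 * (x 0 ^ 2 + x 1 ^ 2) + 2 * α * β * (x 0 * h 0 + x 1 * h 1) +
        β ^ 2 * (h 0 ^ 2 + h 1 ^ 2) := by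
  rw [EuclideanSpace.norm_sq_eq, Fin.sum_univ_three]
  simp only [Real.norm_eq_abs, sq_abs, PiLp.add_apply, PiLp.smul_apply, smul_eq_mul,
    rotGen_apply_zero, rotGen_apply_one, rotGen_apply_two]
  ring

/-- `(h₀² + h₁²)^{1/2} ≤ ‖h‖` on `ℝ³`. [folklore] -/
private theorem sqrt_horiz_le_norm (h : EuclideanSpace ℝ (Fin 3)) :
    Real.sqrt (h 0 ^ 2 + h 1 ^ 2) ≤ ‖h‖ := by
  rw [Real.sqrt_le_left (norm_nonneg _), EuclideanSpace.norm_sq_eq, Fin.sum_univ_three]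
  simp only [Real.norm_eq_abs, sq_abs]
  nlinarith [sq_nonneg (h 2)]

/-- The pointwise sharp bound on vectors: `‖Dv(x)h‖ ≤ |c| φ(aρ) (h₀² + h₁²)^{1/2}`. [cite: Saffman1992, §13.3 eq. (12)] -/
private theorem norm_fderiv_burgersVortexSwirl_apply_le {γ ν : ℝ} (hγ : 0 < γ) (hν : 0 < ν) (Γ : ℝ)
    (x h : EuclideanSpace ℝ (Fin 3)) :
    ‖fderiv ℝ (burgersVortexSwirl γ ν Γ) x h‖ ≤
      |γ * Γ / (8 * Real.pi * ν)| * burgersPhi (γ / (4 * ν) * (x 0 ^ 2 + x 1 ^ 2)) *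
        Real.sqrt (h 0 ^ 2 + h 1 ^ 2) := by
  set c := γ * Γ / (8 * Real.pi * ν) with hc
  set a := γ / (4 * ν) with ha
  set ρ := x 0 ^ 2 + x 1 ^ 2 with hρ
  set P := x 0 * h 0 + x 1 * h 1 with hP
  set H := h 0 ^ 2 + h 1 ^ 2 with hH
  have ha0 : 0 < a := by rw [ha]; positivity
  have hρ0 : 0 ≤ ρ := by rw [hρ]; positivity
  have hH0 : 0 ≤ H := by rw [hH]; positivity
  have hφ0 : 0 < burgersPhi (a * ρ) := burgersPhi_pos _
  -- `Dv(x)h = c • W`, `W = (2aφ'P) Jx + φ Jh`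
  have hsplit : γ / (4 * ν) * (x 0 ^ 2 + x 1 ^ 2) = a * ρ := by rw [ha, hρ]
  have hW : fderiv ℝ (burgersVortexSwirl γ ν Γ) x h =
      c • ((deriv burgersPhi (a * ρ) * a * (2 * P)) • rotGen x + burgersPhi (a * ρ) • rotGen h) := by
    rw [fderiv_burgersVortexSwirl_apply, hsplit, ← hc, ← ha, ← hP, smul_add, smul_smul, smul_smul,
      show c * (deriv burgersPhi (a * ρ) * a * (2 * P)) = c * (deriv burgersPhi (a * ρ) * a) * (2 * P)
        by ring]
  rw [hW, norm_smul, Real.norm_eq_abs,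
    show |c| * burgersPhi (a * ρ) * Real.sqrt H = |c| * (burgersPhi (a * ρ) * Real.sqrt H) by ring]
  refine mul_le_mul_of_nonneg_left ?_ (abs_nonneg _)
  -- `‖W‖² = 4aP²φ'·e^{−aρ} + φ²H ≤ φ²H`
  have hCS : P ^ 2 ≤ ρ * H := by
    rw [hP, hρ, hH]; nlinarith [sq_nonneg (x 0 * h 1 - x 1 * h 0)]
  have hmul : a * ρ * deriv burgersPhi (a * ρ) = Real.exp (-(a * ρ)) - burgersPhi (a * ρ) :=
    StrainedAzimuthal.mul_deriv_burgersPhi (a * ρ)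
  have hsq : ‖(deriv burgersPhi (a * ρ) * a * (2 * P)) • rotGen x + burgersPhi (a * ρ) • rotGen h‖ ^ 2 =
      4 * a * P ^ 2 * deriv burgersPhi (a * ρ) * Real.exp (-(a * ρ)) + burgersPhi (a * ρ) ^ 2 * H := by
    rw [norm_sq_rotGen_comb, ← hρ, ← hP, ← hH]
    have e : Real.exp (-(a * ρ)) = a * ρ * deriv burgersPhi (a * ρ) + burgersPhi (a * ρ) := by
      rw [hmul]; ring
    rw [e]; ring
  have hT : 4 * a * P ^ 2 * deriv burgersPhi (a * ρ) * Real.exp (-(a * ρ)) ≤ 0 := by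
    rcases hρ0.eq_or_lt with h0 | hpos
    · have hP0 : P ^ 2 = 0 := le_antisymm (by rw [← h0, zero_mul] at hCS; exact hCS) (sq_nonneg _)
      rw [hP0]; simp
    · have hd := deriv_burgersPhi_nonpos (mul_pos ha0 hpos)
      have he := Real.exp_pos (-(a * ρ))
      have h1 : 0 ≤ 4 * a * P ^ 2 := by positivity
      nlinarith [mul_nonneg h1 he.le]
  have hle : ‖(deriv burgersPhi (a * ρ) * a * (2 * P)) • rotGen x + burgersPhi (a * ρ) • rotGen h‖ ^ 2 ≤
      (burgersPhi (a * ρ) * Real.sqrt H) ^ 2 := by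
    rw [mul_pow, Real.sq_sqrt hH0, hsq]; linarith
  exact (pow_le_pow_iff_left₀ (norm_nonneg _) (by positivity) two_ne_zero).1 hle

/-- **THE SHARP GRADIENT BOUND: the swirl gradient is at most the local angular velocity.** For
`γ, ν > 0` and every `x`: `‖Dv(x)‖ ≤ |c|·φ(aρ(x))`, `c = γΓ/(8πν)`, `a = γ/4ν`, `φ(s) = (1 − e^{−s})/s`
— the angular velocity `|v(x)|/r = |Γ|(1 − e^{−γr²/4ν})/(2πr²)` of the Burgers swirl at radius `r`
(equality on the test vector `e_θ`; on the axis `φ = 1`, the solid-body rate of Saffman's (12)).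
[cite: Saffman1992, §13.3 eq. (12)] -/
theorem norm_fderiv_burgersVortexSwirl_le_angularVelocity {γ ν : ℝ} (hγ : 0 < γ) (hν : 0 < ν)
    (Γ : ℝ) (x : EuclideanSpace ℝ (Fin 3)) :
    ‖fderiv ℝ (burgersVortexSwirl γ ν Γ) x‖ ≤
      |γ * Γ / (8 * Real.pi * ν)| * burgersPhi (γ / (4 * ν) * (x 0 ^ 2 + x 1 ^ 2)) := by
  refine ContinuousLinearMap.opNorm_le_bound _
    (mul_nonneg (abs_nonneg _) (burgersPhi_pos _).le) fun h => ?_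
  refine (norm_fderiv_burgersVortexSwirl_apply_le hγ hν Γ x h).trans ?_
  exact mul_le_mul_of_nonneg_left (sqrt_horiz_le_norm h)
    (mul_nonneg (abs_nonneg _) (burgersPhi_pos _).le)

/-- **`‖Dv(x)‖ ≤ |c|` everywhere, `c = γΓ/(8πν)` the core rotation rate** (sharp: equality on the
axis, `norm_fderiv_burgersVortexSwirl_axis`; `φ ≤ 1`). [cite: Saffman1992, §13.3 eq. (12)] -/
theorem norm_fderiv_burgersVortexSwirl_le_coreRate {γ ν : ℝ} (hγ : 0 < γ) (hν : 0 < ν) (Γ : ℝ)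
    (x : EuclideanSpace ℝ (Fin 3)) :
    ‖fderiv ℝ (burgersVortexSwirl γ ν Γ) x‖ ≤ |γ * Γ / (8 * Real.pi * ν)| := by
  refine (norm_fderiv_burgersVortexSwirl_le_angularVelocity hγ hν Γ x).trans ?_
  have hs : 0 ≤ γ / (4 * ν) * (x 0 ^ 2 + x 1 ^ 2) := by positivity
  exact mul_le_of_le_one_right (abs_nonneg _) (burgersPhi_le_one hs)

/-- **Far-field decay of the swirl gradient**: off the axis `‖Dv(x)‖ ≤ |Γ|/(2π(x₀² + x₁²))`, the
potential-vortex rate (`φ(s) ≤ 1/s`: `|c|·4ν/(γr²) = |Γ|/(2πr²)`), independent of `γ` and `ν`.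
[cite: Saffman1992, §13.3 eq. (12)] -/
theorem norm_fderiv_burgersVortexSwirl_le_farField {γ ν : ℝ} (hγ : 0 < γ) (hν : 0 < ν) (Γ : ℝ)
    {x : EuclideanSpace ℝ (Fin 3)} (hx : 0 < x 0 ^ 2 + x 1 ^ 2) :
    ‖fderiv ℝ (burgersVortexSwirl γ ν Γ) x‖ ≤ |Γ| / (2 * Real.pi * (x 0 ^ 2 + x 1 ^ 2)) := by
  refine (norm_fderiv_burgersVortexSwirl_le_angularVelocity hγ hν Γ x).trans ?_
  have hs : 0 < γ / (4 * ν) * (x 0 ^ 2 + x 1 ^ 2) := by positivity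
  have hpi := Real.pi_pos
  calc |γ * Γ / (8 * Real.pi * ν)| * burgersPhi (γ / (4 * ν) * (x 0 ^ 2 + x 1 ^ 2))
      ≤ |γ * Γ / (8 * Real.pi * ν)| * (γ / (4 * ν) * (x 0 ^ 2 + x 1 ^ 2))⁻¹ :=
        mul_le_mul_of_nonneg_left (StrainedAzimuthal.burgersPhi_le_inv hs) (abs_nonneg _)
    _ = |Γ| / (2 * Real.pi * (x 0 ^ 2 + x 1 ^ 2)) := by
        rw [abs_div, abs_mul, abs_of_pos hγ, abs_of_pos (by positivity : 0 < 8 * Real.pi * ν)]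
        field_simp
        ring

/-- **The gradient of the full Burgers vortex, sharp form**: for `γ, ν > 0` and every `x`,
`‖D(U_s + v)(x)‖ ≤ |γ| + |c|·φ(aρ(x)) ≤ |γ| + |γΓ/(8πν)|` (strain rate plus local angular velocity).
[cite: Saffman1992, §13.3 eqs. (9), (12)] -/
theorem norm_fderiv_burgersVortex_le_sharp {γ ν : ℝ} (hγ : 0 < γ) (hν : 0 < ν) (Γ : ℝ)
    (x : EuclideanSpace ℝ (Fin 3)) :
    ‖fderiv ℝ (burgersVortex γ ν Γ) x‖ ≤
        |γ| + |γ * Γ / (8 * Real.pi * ν)| * burgersPhi (γ / (4 * ν) * (x 0 ^ 2 + x 1 ^ 2)) ∧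
      ‖fderiv ℝ (burgersVortex γ ν Γ) x‖ ≤ |γ| + |γ * Γ / (8 * Real.pi * ν)| := by
  have hv : DifferentiableAt ℝ (burgersVortexSwirl γ ν Γ) x :=
    ((contDiff_burgersVortexSwirl γ ν Γ (n := 1)).differentiable one_ne_zero) x
  have hU : HasFDerivAt (axisymmetricStrain γ) (linearStrainL (-γ / 2) (-γ / 2) γ) x :=
    hasFDerivAt_linearStrain _ _ _ x
  rw [burgersVortex, fderiv_add hU.differentiableAt hv, hU.fderiv]
  have h1 := (norm_add_le _ _).trans (add_le_add (norm_linearStrainL_axisymmetric_le γ)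
    (norm_fderiv_burgersVortexSwirl_le_angularVelocity hγ hν Γ x))
  refine ⟨h1, h1.trans (add_le_add le_rfl ?_)⟩
  have hs : 0 ≤ γ / (4 * ν) * (x 0 ^ 2 + x 1 ^ 2) := by positivity
  exact mul_le_of_le_one_right (abs_nonneg _) (burgersPhi_le_one hs)

end Literature.Analysis.FluidPDE

end
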